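import Literature.MathematicalPhysics.QuantumFieldTheory.Balaban1983to89.Node00.CriticalOnFibreTopHalving
import Literature.MathematicalPhysics.QuantumFieldTheory.Balaban1983to89.T3DescentFibreTower
import Summits.QuantumFields.YangMills.Theorems.BalabanUVNodesK0TopIndexWrapGeometry
import Summits.QuantumFields.YangMills.Theorems.BalabanUVNodesN07AvoidanceAtFlatData
import Literature.MathematicalPhysics.QuantumFieldTheory.Balaban1983to89.Node00.Record12BgRowCoClassGauge

/-!
# N07 — V14 STUB 1's BINDER BLOCK IS INHABITED: the hypotheses of `Prop8RegSepTopStep` (and of `HalvingStepTop`) hold SIMULTANEOUSLY at the FLAT DATUM on the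
# separated top index, and the conclusion (8) holds there (non-vacuity ∕ A6 witness for K0⁷'s hardest stub; answers ref-G READ208 NOTE-1)

Cell `pub-ymgap`, seat `pub-ymgap-dag-n07-e` generation 12 (R141 (C), DAG node N07 = [15]; cell INBOX INTENT-32 of 2026-08-27).  NEW leaf, PROOF kind (no `def`);
`--kind proof --supports stmt-QuantumFields-20541 --as helper`.  CONSUMED BY NAME, nothing modified: this seat's `Node00.CriticalOnFibreTop` (`Prop8RegSepTopStep`, p524052),
`Node00.CriticalOnFibreTopHalving` (`HalvingStepTop`, p550807), `Node00.CriticalOnFibre` (`isCritOnFibre_of_wilsonAction4_eq_zero`, p514709), `…N07AvoidanceAtFlatData` (`wilsonAction4_one`, p491919); dag-n21-c's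
`K0TopIndexWrapGeometry.exists_seq_top` (the separated TOP index, in tree); the 3D programme's `T3DescentFibreTower.avgFun_one` ∕ `expMeanLogSU_E_one` («Ū = 1 for U = 1»).

WHY (ref-G g15 READ208 NOTE-1 on p550807, cell INBOX l.21861, 2026-08-27 17:38Z): *«the equivalence gives the new fact EXACTLY p524052's vacuity status — no in-file inhabitant
of the binder block (a concrete (ν, s, δ, W, U) with `DataSmall7PTop`, the class, `IsCritOnFibre`) in either file; … V14's `stub_prop8StepCoP13 : ∃ B₃ a₀ a₁, 2L² ≤ B₃ ∧ … ∧
Prop8RegSepTopStep …` IS a knit binder of the skeleton of record — its first discharge will need that witness»*.  THIS FILE SUPPLIES THE WITNESS NOW: for EVERY support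
selector `Sup`, every `B₃ > 0`, `a₀ > 0`, `a₁ > 0`, every numerics `ν` with `0 < ν.M₁`, every cube letter `M ≥ 1`, history `g`, depth `K` and step `k ≥ 1`, the separated top
index `s` of dag-n21-c, the constant thresholds `δ_n := min a₁ (a₀∕B₃)`, the radius `ε₀ := a₀`, the FLAT multi-scale datum `W ≡ 1` and the FLAT configuration `U ≡ 1` satisfy
ALL hypotheses of `Prop8RegSepTopStep F N Sup B₃ a₀ a₁` at once — AND its conclusion (8) (both halves).  So the stub's fact is NOT vacuously true by unsatisfiable binders, and
it is NOT refuted at the flat datum (the regime where this seat's M1–M5 certificates lived is excluded by the typed guards, as designed).  The same for `HalvingStepTop`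
(class radii `ε ≡ a₀`).

CONTENTS.  §1 flat bookkeeping at the objects of record: `iter_avOfRecord_one`, `avgFamily_avOfRecord_one`, `plaqSmallOn_one`, `coDivSum_one`, `coDivSmallOn_one`,
`mixedField_avOfRecord_one`, `dataSmall7PTop_one`, `localGaugeOn_one` (the flat field admits the trivial local gauge `u ≡ 1`, `A ≡ 0` on every site set — so the (152)∕(9) tokens' ∃-gauge conclusions hold at the flat datum too).  §2 ★★ `prop8RegSepTopStep_binders_inhabited_flat`, ★ `halvingStepTop_binders_inhabited_flat`.

HONEST FRAMING: count-neutral kernel NON-VACUITY certificate about the tree's own objects (the flat field is averaged to the flat field, has zero action, unit plaquettes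
and zero co-divergence); nothing of Bałaban asserted or proved; V14 stub 1 ∕ K0⁷ NOT closed (a witness of the HYPOTHESES is not a proof of the ∀-fact); N07 NOT discharged
(5∕27 unmoved); one finite T⁴ programme at fixed ε — NOT continuum ∕ ℝ⁴ ∕ OS ∕ mass gap ∕ Clay.  No `sorry`, no `def`, no `instance`, no `notation`.
-/

noncomputable section

open scoped Matrix.Norms.L2Operator

namespace Summit.QuantumFields.YangMills.BalabanUVNodes.N07Prop8StepFlatWitness

open Literature.MathematicalPhysics.QuantumFieldTheory.Balaban1983to89
open Literature.MathematicalPhysics.QuantumFieldTheory.Balaban1983to89.T4Continuum (T4Family)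
open Literature.MathematicalPhysics.QuantumFieldTheory.Balaban1983to89.B15DeterminingSets
open Literature.MathematicalPhysics.QuantumFieldTheory.Balaban1983to89.Node00
open Summit.QuantumFields.YangMills.Theorems.K0TopIndexWrapGeometry (exists_seq_top)
open Summit.QuantumFields.YangMills.BalabanUVNodes.N07AvoidanceAtFlatData (wilsonAction4_one)

/-! ## §1  Flat bookkeeping at the objects of record -/

section Flat

variable (F : T4Family) (N : ℕ) [NeZero N]

/-- The averaging OF RECORD fixes the flat configuration at every level: `Ū^{(j)}(1) = 1` (print's `exp[mean log]` of a constant family `1` is `1`).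
[cite: Balaban1987RG1, (0.4) p.253 (bookkeeping)] -/
theorem iter_avOfRecord_one (K j : ℕ) : Averaging.iter (avOfRecord F N K) j (1 : GaugeField (F.P K) 0 (SU N)) = 1 := by
  induction j with
  | zero => rfl
  | succ j ih =>
    show (BlockAveraging.blockAvg ExpMeanLog.expMeanLogSU).avg (Averaging.iter (avOfRecord F N K) j (1 : GaugeField (F.P K) 0 (SU N))) = 1
    rw [ih, BlockAveraging.blockAvg_avg, T3DescentFibreTower.avgFun_one _ T3DescentFibreTower.expMeanLogSU_E_one]

/-- The multi-scale family of averages of the flat configuration is flat. [cite: Balaban1987RG1, (0.21) p.256 (bookkeeping)] -/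
theorem avgFamily_avOfRecord_one (K : ℕ) : avgFamily (avOfRecord F N K) (1 : GaugeField (F.P K) 0 (SU N)) = fun _ _ => 1 := by
  funext j b
  show Averaging.iter (avOfRecord F N K) j 1 b = 1
  rw [iter_avOfRecord_one]
  rfl

variable {F N}

/-- The flat configuration has unit plaquette variables: (1.7) at every positive threshold on every plaquette set. [cite: Balaban1985RegularSpaces, (1.7) p.77 (bookkeeping)] -/
theorem plaqSmallOn_one {P : Params} {j : ℕ} (S : Set (Plaq P j)) {r : ℝ} (hr : 0 < r) : PlaqSmallOn S r (1 : GaugeField P j (SU N)) := by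
  intro q _
  have : GaugeField.plaqHol (1 : GaugeField P j (SU N)) q = 1 := by
    show (1 : SU N) * 1 * (1 : SU N)⁻¹ * (1 : SU N)⁻¹ = 1
    simp
  rw [this, GaugeGroup.dist1_one]
  exact hr

/-- The lattice Yang–Mills current of the flat configuration vanishes: `η·(D^{η*}_1 ∂1)(b) = 0`. [cite: Balaban1985RegularSpaces, (1.1)–(1.2) p.76, (1.9) p.77 (bookkeeping)] -/
theorem coDivSum_one {P : Params} {j : ℕ} (x : Site P j) (μ : Fin P.d) : Sect2.coDivSum (1 : GaugeField P j (SU N)) x μ = 0 := by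
  have hp : ∀ (y : Site P j) (α β : Fin P.d) (h : α < β), Sect2.plaqMat (1 : GaugeField P j (SU N)) y α β h = 1 := by
    intro y α β h
    have h1 : GaugeField.plaqHol (1 : GaugeField P j (SU N)) ⟨y, α, β, h⟩ = 1 := by
      show (1 : SU N) * 1 * (1 : SU N)⁻¹ * (1 : SU N)⁻¹ = 1
      simp
    simp only [Sect2.plaqMat, h1, map_one, Units.val_one]
  have h1b : ∀ b : PBond P j, (1 : GaugeField P j (SU N)) b = 1 := fun _ => rfl
  have ht : ∀ (ν α β : Fin P.d) (h : α < β), Sect2.coDivTerm (1 : GaugeField P j (SU N)) x ν α β h = 0 := by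
    intro ν α β h
    simp only [Sect2.coDivTerm, hp, h1b, map_one, inv_one, Units.val_one, one_mul, sub_self]
  unfold Sect2.coDivSum
  refine Finset.sum_eq_zero fun ν _ => ?_
  split_ifs <;> simp [ht]

/-- (1.9) for the flat configuration at every positive threshold on every bond set. [cite: Balaban1985RegularSpaces, (1.9) p.77 (bookkeeping)] -/
theorem coDivSmallOn_one {P : Params} {j : ℕ} (S : Set (PBond P j)) {r : ℝ} (hr : 0 < r) : Sect2.CoDivSmallOn S r (1 : GaugeField P j (SU N)) := by
  intro b _
  rw [coDivSum_one, norm_zero]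
  exact hr

/-- The MIXED field of two flat levels is flat (the off-constraint bonds read `Ū(1) = 1`). [cite: Balaban1985Variational, (7) p.278 (bookkeeping)] -/
theorem mixedField_avOfRecord_one (K : ℕ) {m : ℕ} (S : Set (Site (F.P K) (m + 1))) :
    Sect2.mixedField (avOfRecord F N K) S (1 : GaugeField (F.P K) (m + 1) (SU N)) (1 : GaugeField (F.P K) m (SU N)) = 1 := by
  funext b
  unfold Sect2.mixedField
  split_ifs with hb
  · rfl
  · show (BlockAveraging.blockAvg ExpMeanLog.expMeanLogSU).avg (1 : GaugeField (F.P K) m (SU N)) b = 1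
    rw [BlockAveraging.blockAvg_avg, T3DescentFibreTower.avgFun_one _ T3DescentFibreTower.expMeanLogSU_E_one]
    rfl

/-- Print's data condition (7) (top-domain printed range) holds for the FLAT multi-scale datum at every positive threshold profile.
[cite: Balaban1985Variational, (7) p.278 (bookkeeping)] -/
theorem dataSmall7PTop_one (K : ℕ) (Ω : ℕ → Set (Site (F.P K) 0)) (Ω₀ : Set (Site (F.P K) 0)) (k : ℕ) {δ : ℕ → ℝ} (hδ : ∀ n, n ≤ k → 0 < δ n) :
    Sect2.DataSmall7PTop (avOfRecord F N K) Ω Ω₀ k δ (fun _ _ => (1 : SU N)) := by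
  refine ⟨plaqSmallOn_one _ (hδ 0 (Nat.zero_le _)), fun m hm => ?_⟩
  have h1 : Sect2.mixedField (avOfRecord F N K) (genSet Ω k (m + 1)) ((fun _ _ => (1 : SU N)) (m + 1)) ((fun _ _ => (1 : SU N)) m) =
      (1 : GaugeField (F.P K) (m + 1) (SU N)) := mixedField_avOfRecord_one K _
  rw [h1]
  exact plaqSmallOn_one _ (hδ (m + 1) hm)

/-- The flat configuration admits the TRIVIAL local gauge on every site set, at every unit `ξ` and every positive threshold: `u ≡ 1`, `A ≡ 0` (`1^1 = 1 = e^{iξ·0}`,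
`‖0‖ = 0 < t`, `∇^ξ 0 = 0`) — so the ∃-gauge conclusions of the (152)∕(9) tokens (`Sect2.LocalGaugeOn`, def-P11 FILE 14's letter) hold at the flat datum on EVERY cube.
[cite: Balaban1987RG1, (1.12) p.262; Balaban1985Variational, Thm 1 (9) p.279 (bookkeeping)] -/
theorem localGaugeOn_one {P : Params} (Y : Set (Site P 0)) (ξ : ℝ) {t : ℝ} (ht : 0 < t) : Sect2.LocalGaugeOn Y ξ t (1 : GaugeField P 0 (SU N)) := by
  have h1b : ∀ b : PBond P 0, (1 : GaugeField P 0 (SU N)) b = 1 := fun _ => rfl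
  refine ⟨fun _ => 1, fun _ => 0, fun b _ => ?_, fun b _ => by simpa using ht, fun q _ => ?_⟩
  · show ιSU N 1 * ιSU N ((1 : GaugeField P 0 (SU N)) b) * (ιSU N 1)⁻¹ = B12RegularSpaces111.expI ξ (0 : MatA N)
    rw [B12RegularSpaces111Mono.expI_zero, h1b, map_one, inv_one, mul_one, mul_one]
  · simp only [B12RegularSpaces111.grad, sub_self, smul_zero, norm_zero]
    exact ht

end Flat

/-! ## §2  ★★ The binder blocks of `Prop8RegSepTopStep` and `HalvingStepTop` are inhabited (flat datum, separated top index), with the conclusion holding -/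

section Witness

variable (F : T4Family) (N : ℕ) [NeZero N]

/-- `0 < η_n` on the lattices of record. [cite: Balaban1987RG1, (1.1) p.260 (bookkeeping)] -/
private theorem eta_pos' (P : Params) (n : ℕ) : 0 < P.eta n := by
  unfold Params.eta
  exact pow_pos (inv_pos.mpr (Nat.cast_pos.mpr P.L_pos)) n

/-- ★★ **V14 STUB 1's BINDER BLOCK IS INHABITED, AND (8) HOLDS THERE.**  For every support selector, `B₃ > 0`, `a₀, a₁ > 0`, numerics `ν` with `0 < ν.M₁`, cube letter
`M ≥ 1`, history `g`, depth `K`, step `k ≥ 1`: there are a SEPARATED (2.18) index `s` (dag-n21-c's top index), a radius `ε₀`, thresholds `δ`, a datum `W` and a configuration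
`U` satisfying EVERY hypothesis of `Prop8RegSepTopStep F N Sup B₃ a₀ a₁` (threshold sandwich and two-sided comparability, (7) on the top-domain printed range, class (6) on
the top domain — (1.7) and (1.9) —, `U` on the fibre of `W`, `U` critical on that fibre) together with its conclusion (8) (both halves).  Witness: `ε₀ := a₀`,
`δ_n := min a₁ (a₀∕B₃)`, `W ≡ 1`, `U ≡ 1` (zero action ⇒ critical on every fibre, p514709; averaged to itself at every level).
[cite: Balaban1985Variational, Prop. 8 p.304, (2)–(8) pp.278–279; Balaban1985RegularSpaces, (1.7)–(1.9) p.77; Balaban1988Convergent, (2.18) p.257] -/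
theorem prop8RegSepTopStep_binders_inhabited_flat
    (Sup : (ν : Stage7Numerics) → (K : ℕ) → (ℕ → Set (Site (F.P K) 0)) → Set (Site (F.P K) 0)) {B₃ a₀ a₁ : ℝ} (hB₃ : 0 < B₃) (ha₀ : 0 < a₀)
    (ha₁ : 0 < a₁) (ν : Stage7Numerics) (hM₁ : 0 < ν.M₁) {M : ℕ} (hM : 1 ≤ M) (g : ℕ → ℝ) (K k : ℕ) (hk : 1 ≤ k) :
    ∃ (s : SeqOfRecord F ν M g K k) (ε₀ : ℝ) (δ : ℕ → ℝ) (W : MSField (F.P K) (SU N)) (U : GaugeField (F.P K) 0 (SU N)),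
      Sect2.SeqSeparated ν.M₁ s ∧ 0 < ν.M₁ ∧ 1 ≤ k ∧
      (∀ n, n ≤ k → 0 < δ n ∧ δ n ≤ a₁ ∧ B₃ * δ n ≤ ε₀) ∧ (∀ n, n < k → δ n ≤ 2 * δ (n + 1)) ∧ (∀ n, n < k → δ (n + 1) ≤ 2 * δ n) ∧
      ε₀ ≤ a₀ ∧ Sect2.DataSmall7PTop (avOfRecord F N K) s.Ω (Sup ν K s.Ω) k δ W ∧
      (∀ n, n ≤ k → PlaqSmallOn (Sect2.omegaPlaqsTop s.Ω (Sup ν K s.Ω) n) (ε₀ * (F.P K).eta n ^ 2) U) ∧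
      Sect2.CoDivClassOnTop s.Ω (Sup ν K s.Ω) k ε₀ U ∧ AgreeOn (genSet s.Ω k) (avgFamily (avOfRecord F N K) U) W ∧
      IsCritOnFibre F N K (genSet s.Ω k) W U ∧
      ((∀ n, n ≤ k → PlaqSmallOn (Sect2.omegaPlaqsTop s.Ω (Sup ν K s.Ω) n) (B₃ * δ n * (F.P K).eta n ^ 2) U) ∧
        ∀ n, n ≤ k → Sect2.CoDivSmallOn (Sect2.omegaBondsTop s.Ω (Sup ν K s.Ω) n) (B₃ * δ n * (F.P K).eta n ^ 3) U) := by
  obtain ⟨s, -, hsep⟩ := exists_seq_top F ν hM g K k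
  have hδ0 : 0 < min a₁ (a₀ / B₃) := lt_min ha₁ (div_pos ha₀ hB₃)
  have hBδ : B₃ * min a₁ (a₀ / B₃) ≤ a₀ :=
    (mul_le_mul_of_nonneg_left (min_le_right _ _) hB₃.le).trans (by rw [mul_div_cancel₀ _ hB₃.ne'])
  have hη : ∀ n, 0 < (F.P K).eta n := eta_pos' (F.P K)
  refine ⟨s, a₀, fun _ => min a₁ (a₀ / B₃), fun _ _ => 1, 1, hsep, hM₁, hk, fun n _ => ⟨hδ0, min_le_left _ _, hBδ⟩,
    fun n _ => by linarith, fun n _ => by linarith, le_rfl, dataSmall7PTop_one K _ _ k fun n _ => hδ0,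
    fun n _ => plaqSmallOn_one _ (mul_pos ha₀ (pow_pos (hη n) 2)), fun n _ => coDivSmallOn_one _ (mul_pos ha₀ (pow_pos (hη n) 3)), ?_,
    isCritOnFibre_of_wilsonAction4_eq_zero wilsonAction4_one,
    fun n _ => plaqSmallOn_one _ (mul_pos (mul_pos hB₃ hδ0) (pow_pos (hη n) 2)), fun n _ => coDivSmallOn_one _ (mul_pos (mul_pos hB₃ hδ0) (pow_pos (hη n) 3))⟩
  -- the flat configuration lies on the fibre of the flat datum
  intro j b _
  rw [avgFamily_avOfRecord_one]

/-- ★ The same for module 30's `HalvingStepTop` binder block (class radii `ε ≡ a₀`): inhabited at the flat datum on the separated top index, with its conclusion (the class at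
the halved radii `max{B₃δ_n, ½a₀}`) holding. [cite: Balaban1985Variational, p.304 before Prop. 8 (bookkeeping)] -/
theorem halvingStepTop_binders_inhabited_flat
    (Sup : (ν : Stage7Numerics) → (K : ℕ) → (ℕ → Set (Site (F.P K) 0)) → Set (Site (F.P K) 0)) {B₃ a₀ a₁ : ℝ} (hB₃ : 0 < B₃) (ha₀ : 0 < a₀)
    (ha₁ : 0 < a₁) (ν : Stage7Numerics) (hM₁ : 0 < ν.M₁) {M : ℕ} (hM : 1 ≤ M) (g : ℕ → ℝ) (K k : ℕ) (hk : 1 ≤ k) :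
    ∃ (s : SeqOfRecord F ν M g K k) (ε δ : ℕ → ℝ) (W : MSField (F.P K) (SU N)) (U : GaugeField (F.P K) 0 (SU N)),
      Sect2.SeqSeparated ν.M₁ s ∧ 0 < ν.M₁ ∧ 1 ≤ k ∧
      (∀ n, n ≤ k → 0 < δ n ∧ δ n ≤ a₁) ∧ (∀ n, n < k → δ n ≤ 2 * δ (n + 1)) ∧ (∀ n, n < k → δ (n + 1) ≤ 2 * δ n) ∧
      (∀ n, n ≤ k → B₃ * δ n ≤ ε n ∧ ε n ≤ a₀) ∧ (∀ n, n < k → ε n ≤ 2 * ε (n + 1)) ∧ (∀ n, n < k → ε (n + 1) ≤ 2 * ε n) ∧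
      Sect2.DataSmall7PTop (avOfRecord F N K) s.Ω (Sup ν K s.Ω) k δ W ∧
      (∀ n, n ≤ k → PlaqSmallOn (Sect2.omegaPlaqsTop s.Ω (Sup ν K s.Ω) n) (ε n * (F.P K).eta n ^ 2) U) ∧
      (∀ n, n ≤ k → Sect2.CoDivSmallOn (Sect2.omegaBondsTop s.Ω (Sup ν K s.Ω) n) (ε n * (F.P K).eta n ^ 3) U) ∧
      AgreeOn (genSet s.Ω k) (avgFamily (avOfRecord F N K) U) W ∧ IsCritOnFibre F N K (genSet s.Ω k) W U ∧
      ((∀ n, n ≤ k → PlaqSmallOn (Sect2.omegaPlaqsTop s.Ω (Sup ν K s.Ω) n) (max (B₃ * δ n) (ε n / 2) * (F.P K).eta n ^ 2) U) ∧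
        ∀ n, n ≤ k → Sect2.CoDivSmallOn (Sect2.omegaBondsTop s.Ω (Sup ν K s.Ω) n) (max (B₃ * δ n) (ε n / 2) * (F.P K).eta n ^ 3) U) := by
  obtain ⟨s, -, hsep⟩ := exists_seq_top F ν hM g K k
  have hδ0 : 0 < min a₁ (a₀ / B₃) := lt_min ha₁ (div_pos ha₀ hB₃)
  have hBδ : B₃ * min a₁ (a₀ / B₃) ≤ a₀ :=
    (mul_le_mul_of_nonneg_left (min_le_right _ _) hB₃.le).trans (by rw [mul_div_cancel₀ _ hB₃.ne'])
  have hη : ∀ n, 0 < (F.P K).eta n := eta_pos' (F.P K)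
  have hmax : ∀ n : ℕ, 0 < max (B₃ * min a₁ (a₀ / B₃)) (a₀ / 2) := fun _ => lt_max_of_lt_right (half_pos ha₀)
  refine ⟨s, fun _ => a₀, fun _ => min a₁ (a₀ / B₃), fun _ _ => 1, 1, hsep, hM₁, hk, fun n _ => ⟨hδ0, min_le_left _ _⟩,
    fun n _ => by linarith, fun n _ => by linarith, fun n _ => ⟨hBδ, le_rfl⟩, fun n _ => by linarith, fun n _ => by linarith,
    dataSmall7PTop_one K _ _ k fun n _ => hδ0,
    fun n _ => plaqSmallOn_one _ (mul_pos ha₀ (pow_pos (hη n) 2)), fun n _ => coDivSmallOn_one _ (mul_pos ha₀ (pow_pos (hη n) 3)), ?_,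
    isCritOnFibre_of_wilsonAction4_eq_zero wilsonAction4_one,
    fun n _ => plaqSmallOn_one _ (mul_pos (hmax n) (pow_pos (hη n) 2)), fun n _ => coDivSmallOn_one _ (mul_pos (hmax n) (pow_pos (hη n) 3))⟩
  intro j b _
  rw [avgFamily_avOfRecord_one]

end Witness

end Summit.QuantumFields.YangMills.BalabanUVNodes.N07Prop8StepFlatWitness

end
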